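import Literature.Computability.Cryptography.ShorAssemblyLeavesProofs
import Literature.Computability.QuantumComplexity.CWrapAssembly
import Literature.Computability.Cryptography.QubitRegisterCliffordTProofs
import Literature.Computability.Complexity.AdaptiveBPPSimulation
import Literature.Computability.Complexity.ListFoldBricks
import HarnessLib

/-!
# Worst-case Φ-hiding for `e = 3` fails under the collapse `BQP ⊆ BPP`

Folklore (Cachin–Micali–Stadler 1999, §2: the Φ-Hiding Assumption is at most as strong as the
hardness of factoring; Shor 1997, §5: factoring is in `FBQP`): if `BQP ⊆ BPP` then the residue
modulo `3` of the least prime factor of `N` is computable by a probabilistic polynomial-time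
algorithm, hence so is the "hidden Eisenstein type" of `N = pq` — whether `3 ∣ p - 1` — on
every family on which `p ≡ q (mod 3)`, in particular on the pure-cubic promise family
`{pq ≡ 1 (mod 9) : p ≡ q ≡ 1 (mod 3) or {p, q} ≡ {2, 5} (mod 9)}` used by the quantum-advantage
line `LinnikCubicClassGroups / honda-leak`.

* `exists_randAlg_minFac_mod_three_of_BQP_subset_BPP` — under `BQP ⊆ BPP` some PPT algorithm
  `D : {0,1}* → {0,1}` outputs `[minFac N ≡ 1 (mod 3)]` with probability `≥ 3/4` on the binary
  encoding of every `N ≥ 2`;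
* `exists_randAlg_phiHidingThree_of_BQP_subset_BPP` — hence a PPT decider of `[p ≡ 1 (mod 3)]`
  from `pq` on the promise family, with probability `≥ 2/3` (the negation of worst-case Φ-hiding
  for `e = 3` there).

Proof, entirely inside the tree's toolkit (no machine and no circuit is written here): Shor's
theorem in `FBQP` form (`isQSolvable_factoring_holds`: the prime factorisation, least factor
first, is written as a prefix of the measured string) is wrapped
(`isQSolvable_classicalWrap_holds`, Bernstein–Vazirani 1997 §8) with the `FP` post-processor
`⟨z, y⟩ ↦ [y₁ ≠ ε ∧ ⟦(y₂)₁⟧ ≡ 1 (mod 3)]` reading the unary length header `y₁` and the first list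
entry `(y₂)₁ = encodeNat (minFac N)` of the list code (`Encoding.listBool`); the guard `y₁ ≠ ε`
makes the written bit a function of the input also when `N ≤ 1` (empty factor list). So the
language `{z | 2 ≤ N ∧ minFac N ≡ 1 (3)}`, `N = decodeNat z₁`, is in `BQP`
(`mem_BQP_of_isQSolvable_bit`), hence in `BPP`; one oracle query (`exists_randAlg_adFn` with
`q = 1`, Arora–Barak 2009 §7.4.1) gives a PPT algorithm printing the bit as a one-letter word with
probability `≥ 3/4`, and the `FP` post-processing `l ↦ [⟦l⟧ ≡ 1 (mod 3)]` returns it as a `Bool`.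

## References

* C. Cachin, S. Micali, M. Stadler, *Computationally private information retrieval with
  polylogarithmic communication*, EUROCRYPT '99, LNCS 1592, §2 (Φ-Hiding Assumption; "breaking
  it is no harder than factoring").
* P. W. Shor, SIAM J. Comput. 26 (1997), §5.
* E. Bernstein, U. Vazirani, SIAM J. Comput. 26 (1997), §8.
* S. Arora, B. Barak, *Computational Complexity*, CUP 2009, §7.4.1.
-/

noncomputable section

namespace Literature.Computability.Cryptography

open _root_.Computability Polynomial
open Literature.Computability.Complexity Literature.Computability.Complexity.Brick
open Literature.Computability.Complexity.AdQuery

/-! ### The post-processing `l ↦ [⟦l⟧ ≡ 1 (mod 3)]` -/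

/-- The word function `l ↦ eqValFn ⟨remFn ⟨l, 3⟩, 1⟩` is in `FP`. [folklore] -/
theorem modThreeEqOneFn_mem_FP :
    (eqValFn ∘ fanoutFn (remFn ∘ fanoutFn id (fun _ => encodeNat 3)) (fun _ => encodeNat 1))
      ∈ FP :=
  comp_mem_FP eqValFn_mem_FP
    (fanoutFn_mem_FP
      (comp_mem_FP remFn_mem_FP
        (fanoutFn_mem_FP (PolyTimeComputable.id (id : List Bool → List Bool))
          (const_mem_FP (encodeNat 3))))
      (const_mem_FP (encodeNat 1)))

/-- Value of the word function: `[decide (⟦l⟧ mod 3 = 1)]`. [folklore] -/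
theorem modThreeEqOneFn_apply (l : List Bool) :
    (eqValFn ∘ fanoutFn (remFn ∘ fanoutFn id (fun _ => encodeNat 3)) (fun _ => encodeNat 1)) l
      = [decide (bitsToNat l % 3 = 1)] := by
  simp [Function.comp]

/-- `l ↦ [⟦l⟧ ≡ 1 (mod 3)]` is polynomial-time as a map `List Bool → Bool` under the encoders
`id`, `encodeBool`. [folklore] -/
theorem modThreeEqOne_polyTime :
    PolyTimeComputable (id : List Bool → List Bool) encodeBool
      (fun l : List Bool => decide (bitsToNat l % 3 = 1)) :=
  PolyTimeComputable.of_encode_eq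
    (f := eqValFn ∘ fanoutFn (remFn ∘ fanoutFn id (fun _ => encodeNat 3)) (fun _ => encodeNat 1))
    (ea := (id : List Bool → List Bool)) (eb := (id : List Bool → List Bool))
    (id : List Bool → List Bool) (fun _ => rfl)
    (fun l => by rw [id, modThreeEqOneFn_apply]; rfl) modThreeEqOneFn_mem_FP

/-- Post-composing a PPT word algorithm with `l ↦ [⟦l⟧ ≡ 1 (mod 3)]` gives a PPT `Bool`-valued
algorithm (`PolyTimeComputable.comp_holds`). [folklore] -/
theorem isPolyTime_modThreeEqOne {A : RandAlg (List Bool) (List Bool)} (hA : A.IsPolyTime id id) :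
    ({ run := fun x r => decide (bitsToNat (A.run x r) % 3 = 1), coinLen := A.coinLen } :
      RandAlg (List Bool) Bool).IsPolyTime id encodeBool :=
  ⟨PolyTimeComputable.comp_holds modThreeEqOne_polyTime hA.1, hA.2⟩

/-- Output law of the derived algorithm = push-forward of `A`'s output law. [folklore] -/
theorem outputPMF_modThreeEqOne (A : RandAlg (List Bool) (List Bool)) (x : List Bool) :
    ({ run := fun x r => decide (bitsToNat (A.run x r) % 3 = 1), coinLen := A.coinLen } :
      RandAlg (List Bool) Bool).outputPMF id x =
      (A.outputPMF id x).map (fun l : List Bool => decide (bitsToNat l % 3 = 1)) := by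
  simp only [RandAlg.outputPMF, PMF.map_comp]
  rfl

/-- Push-forward monotonicity: `Pr[A = [c]] ≤ Pr[derived = c]`, since `⟦[c]⟧ mod 3 = 1 ↔ c`.
[folklore] -/
theorem pr_singleton_le_pr_modThreeEqOne (A : RandAlg (List Bool) (List Bool)) (x : List Bool)
    (c : Bool) :
    A.pr id x {[c]} ≤
      ({ run := fun x r => decide (bitsToNat (A.run x r) % 3 = 1), coinLen := A.coinLen } :
        RandAlg (List Bool) Bool).pr id x {b | b = c} := by
  unfold RandAlg.pr
  rw [outputPMF_modThreeEqOne, PMF.toOuterMeasure_map_apply]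
  have hle1 : (A.outputPMF id x).toOuterMeasure
      ((fun l : List Bool => decide (bitsToNat l % 3 = 1)) ⁻¹' {b | b = c}) ≤ 1 :=
    calc (A.outputPMF id x).toOuterMeasure
          ((fun l : List Bool => decide (bitsToNat l % 3 = 1)) ⁻¹' {b | b = c})
        ≤ (A.outputPMF id x).toOuterMeasure Set.univ :=
          (A.outputPMF id x).toOuterMeasure.mono (Set.subset_univ _)
      _ = 1 := (PMF.toOuterMeasure_apply_eq_one_iff _ _).2 (Set.subset_univ _)
  refine ENNReal.toReal_mono (ne_top_of_le_ne_top ENNReal.one_ne_top hle1) ?_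
  refine (A.outputPMF id x).toOuterMeasure.mono ?_
  intro w hw
  rw [Set.mem_singleton_iff] at hw
  subst hw
  cases c <;> simp

/-! ### The quantum post-processor reading the least prime factor -/

/-- The `FP` post-processor of the wrap, `⟨z, y⟩ ↦ [y₁ ≠ ε && ⟦(y₂)₁⟧ ≡ 1 (mod 3)]`
(`y₁ = fstF y`, `(y₂)₁ = fstF (sndF y)`), is in `FP` (brick algebra). [folklore] -/
theorem phiPost_mem_FP :
    (andFn (notFn (isNilFn ∘ fstF ∘ sndF))
      (eqValFn ∘ fanoutFn (remFn ∘ fanoutFn (fstF ∘ sndF ∘ sndF) (fun _ => encodeNat 3))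
        (fun _ => encodeNat 1))) ∈ FP :=
  andFn_mem_FP (notFn_mem_FP (comp_mem_FP isNilFn_mem_FP (comp_mem_FP fstF_mem_FP sndF_mem_FP)))
    (comp_mem_FP eqValFn_mem_FP
      (fanoutFn_mem_FP
        (comp_mem_FP remFn_mem_FP
          (fanoutFn_mem_FP (comp_mem_FP fstF_mem_FP (comp_mem_FP sndF_mem_FP sndF_mem_FP))
            (const_mem_FP (encodeNat 3))))
        (const_mem_FP (encodeNat 1))))

/-- Value of the post-processor on `⟨z, ⟨h, t⟩⟩`: `[h ≠ ε && ⟦t₁⟧ ≡ 1 (mod 3)]`. [folklore] -/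
theorem phiPost_boolPair (z h t : List Bool) :
    (andFn (notFn (isNilFn ∘ fstF ∘ sndF))
      (eqValFn ∘ fanoutFn (remFn ∘ fanoutFn (fstF ∘ sndF ∘ sndF) (fun _ => encodeNat 3))
        (fun _ => encodeNat 1)))
        (boolPair z (boolPair h t)) =
      [!decide (h = []) && decide (bitsToNat (fstF t) % 3 = 1)] := by
  refine andFn_apply (notFn_apply ?_) ?_
  · simp [Function.comp, isNilFn]
  · simp [Function.comp]

/-- The list code of a nonempty list of naturals, followed by anything, is
`⟨1^{|L|+1}, ⟨encodeNat p, …⟩⟩`. [Arora–Barak 2009, §0.1] [folklore] -/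
theorem encode_cons_append (p : ℕ) (L : List ℕ) (w : List Bool) :
    encodingListNatBool.encode (p :: L) ++ w =
      boolPair (true :: unaryEncodeNat L.length)
        (boolPair (encodeNat p) (L.foldr (fun a acc => boolPair (encodeNat a) acc) [] ++ w)) := by
  show boolPair (unaryEncodeNat (p :: L).length)
      ((p :: L).foldr (fun a acc => boolPair (encodingNatBool.encode a) acc) []) ++ w = _
  rw [boolPair_append, List.foldr_cons, boolPair_append]
  rfl

/-- The list code of the empty list, followed by `w`, is `⟨ε, w⟩`. [folklore] -/
theorem encode_nil_append (w : List Bool) :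
    encodingListNatBool.encode ([] : List ℕ) ++ w = boolPair [] w := by
  show boolPair (unaryEncodeNat 0) [] ++ w = _
  rw [boolPair_append]
  rfl

/-- On a measured string `y` carrying the factor list of `N = decodeNat z₁` as a prefix, the
post-processor writes the bit `[2 ≤ N ∧ minFac N ≡ 1 (mod 3)]`. [folklore] -/
theorem phiPost_of_prefix {z y : List Bool}
    (hy : encodingListNatBool.encode (decodeNat (fstF z)).primeFactorsList <+: y) :
    (andFn (notFn (isNilFn ∘ fstF ∘ sndF))
      (eqValFn ∘ fanoutFn (remFn ∘ fanoutFn (fstF ∘ sndF ∘ sndF) (fun _ => encodeNat 3))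
        (fun _ => encodeNat 1)))
        (boolPair z y) = [decide (2 ≤ decodeNat (fstF z) ∧ (decodeNat (fstF z)).minFac % 3 = 1)] := by
  obtain ⟨t, rfl⟩ := hy
  rcases Nat.lt_or_ge (decodeNat (fstF z)) 2 with hlt | hge
  · have hnil : (decodeNat (fstF z)).primeFactorsList = [] := by
      rcases (show decodeNat (fstF z) = 0 ∨ decodeNat (fstF z) = 1 by omega) with h | h
      · rw [h, Nat.primeFactorsList_zero]
      · rw [h, Nat.primeFactorsList_one]
    rw [hnil, encode_nil_append, phiPost_boolPair]
    simp [Nat.not_le.2 hlt]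
  · obtain ⟨k, hk⟩ : ∃ k, decodeNat (fstF z) = k + 2 := ⟨decodeNat (fstF z) - 2, by omega⟩
    rw [hk, Nat.primeFactorsList_add_two, encode_cons_append, phiPost_boolPair]
    simp

/-! ### The language `{z | 2 ≤ N ∧ minFac N ≡ 1 (mod 3)}` is in `BQP` -/

/-- **Shor + classical wrap**: the language `{z | 2 ≤ N ∧ minFac N ≡ 1 (mod 3)}`
(`N = decodeNat z₁`) is in `BQP`. [Shor 1997, §5; Bernstein–Vazirani 1997, §8] [folklore] -/
theorem phiBitLang_mem_BQP :
    {z : List Bool | decide (2 ≤ decodeNat (fstF z) ∧ (decodeNat (fstF z)).minFac % 3 = 1) = true} ∈ BQP := by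
  have hsolv : IsQSolvable fun x =>
      {y | encodingListNatBool.encode (decodeNat x).primeFactorsList <+: y} :=
    isQSolvable_factoring_holds
  have hwrap := isQSolvable_classicalWrap_holds fstF _ fstF_mem_FP phiPost_mem_FP hsolv
  have hbit : IsQSolvable fun z => {w | [decide (2 ≤ decodeNat (fstF z) ∧ (decodeNat (fstF z)).minFac % 3 = 1)] <+: w} := by
    refine hwrap.mono fun z => ?_
    rintro w ⟨y, hy, hw⟩
    rwa [phiPost_of_prefix hy] at hw
  exact mem_BQP_of_isQSolvable_bit (fun _ _ => QCircuit.outputPMF_apply_holds)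
    cliffordT_isUnitary_holds (fun z => Iff.rfl) hbit

/-! ### Under `BQP ⊆ BPP`: a PPT algorithm for `minFac N mod 3` -/

/-- One query, returned verbatim: `adFn id 1 sndF S x = [S(⟨x, ε⟩)]`. [folklore] -/
theorem adFn_one_sndF (S : Set (List Bool)) (x : List Bool) :
    adFn id 1 sndF S x = [S.boolIndicator (boolPair x [])] := by
  rw [adFn_apply, sndF_boolPair, eval_one]
  rfl

/-- The indicator of the language at `⟨x, ε⟩` is `[2 ≤ N ∧ minFac N ≡ 1 (mod 3)]`,
`N = decodeNat x`. [folklore] -/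
theorem boolIndicator_phiBitLang (x : List Bool) :
    {z : List Bool | decide (2 ≤ decodeNat (fstF z) ∧ (decodeNat (fstF z)).minFac % 3 = 1) = true}.boolIndicator
        (boolPair x []) = decide (2 ≤ decodeNat x ∧ (decodeNat x).minFac % 3 = 1) := by
  have key : boolPair x [] ∈ {z : List Bool | decide (2 ≤ decodeNat (fstF z) ∧ (decodeNat (fstF z)).minFac % 3 = 1) = true} ↔
      decide (2 ≤ decodeNat x ∧ (decodeNat x).minFac % 3 = 1) = true := by simp
  cases h : decide (2 ≤ decodeNat x ∧ (decodeNat x).minFac % 3 = 1)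
  · exact (Set.notMem_iff_boolIndicator _ _).1 fun hs => by
      have h' := key.1 hs; rw [h] at h'; exact Bool.false_ne_true h'
  · exact (Set.mem_iff_boolIndicator _ _).1 (key.2 h)

/-- **Under `BQP ⊆ BPP`, the residue mod `3` of the least prime factor is PPT-computable**:
some probabilistic polynomial-time `D : {0,1}* → {0,1}` outputs `[minFac N ≡ 1 (mod 3)]` with
probability `≥ 3/4` on the binary encoding of every `N ≥ 2`. (Shor's theorem in `FBQP` form,
classical wrap, and the pseudo-deterministic simulation of one `BPP` query.)
[Shor 1997, §5; Cachin–Micali–Stadler 1999, §2; Arora–Barak 2009, §7.4.1] [folklore] -/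
theorem exists_randAlg_minFac_mod_three_of_BQP_subset_BPP (hsub : BQP ⊆ BPP) :
    ∃ D : RandAlg (List Bool) Bool, D.IsPolyTime id encodeBool ∧
      ∀ N : ℕ, 2 ≤ N →
        (3 : ℝ) / 4 ≤ D.pr id (encodeNat N) {b | b = decide (N.minFac % 3 = 1)} := by
  have hL := hsub phiBitLang_mem_BQP
  obtain ⟨R, hR, -, hpr⟩ :=
    AdBPPSim.exists_randAlg_adFn hL OracleCompose.id_mem_FP sndF_mem_FP (1 : Polynomial ℕ)
  refine ⟨{ run := fun x r => decide (bitsToNat (R.run x r) % 3 = 1), coinLen := R.coinLen },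
    isPolyTime_modThreeEqOne hR, fun N hN => ?_⟩
  have h := hpr (encodeNat N)
  rw [adFn_one_sndF, boolIndicator_phiBitLang, decode_encodeNat] at h
  have hdec : decide (2 ≤ N ∧ N.minFac % 3 = 1) = decide (N.minFac % 3 = 1) := by
    by_cases h3 : N.minFac % 3 = 1 <;> simp [h3, hN]
  rw [hdec] at h
  exact h.trans (pr_singleton_le_pr_modThreeEqOne R (encodeNat N) _)

/-- The least prime factor of a product of two primes is one of them. [folklore] -/
theorem minFac_mul_eq_or {p q : ℕ} (hp : p.Prime) (hq : q.Prime) :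
    (p * q).minFac = p ∨ (p * q).minFac = q := by
  have hne : p * q ≠ 1 := by
    intro h
    exact hp.one_lt.ne' (Nat.eq_one_of_mul_eq_one_right h)
  have hm : (p * q).minFac.Prime := Nat.minFac_prime hne
  rcases (hm.dvd_mul).1 (Nat.minFac_dvd (p * q)) with h | h
  · rcases (Nat.dvd_prime hp).1 h with h1 | h1
    · exact absurd h1 hm.one_lt.ne'
    · exact Or.inl h1
  · rcases (Nat.dvd_prime hq).1 h with h1 | h1
    · exact absurd h1 hm.one_lt.ne'
    · exact Or.inr h1

/-- **Worst-case Φ-hiding for `e = 3` fails on the pure-cubic promise family under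
`BQP ⊆ BPP`.** If `BQP ⊆ BPP` then some PPT `D` decides, from the binary encoding of `N = pq`
(`p ≠ q` primes, `pq ≡ 1 (mod 9)`, promise `p ≡ q ≡ 1 (mod 3)` or `{p, q} ≡ {2, 5} (mod 9)`),
whether `p ≡ 1 (mod 3)`, with probability `≥ 2/3`: on the promise family `p ≡ q (mod 3)`, so the
residue of the least prime factor is the answer. This is the negation of the hypothesis-type leaf
`stub_phiHiding3` of the quantum-advantage line `LinnikCubicClassGroups / honda-leak`; together
with that line's transfer it shows the leaf implies `BQP ⊄ BPP` by itself.
[Cachin–Micali–Stadler 1999, §2; Shor 1997, §5] [folklore] -/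
theorem exists_randAlg_phiHidingThree_of_BQP_subset_BPP (hsub : BQP ⊆ BPP) :
    ∃ D : RandAlg (List Bool) Bool, D.IsPolyTime id encodeBool ∧
      ∀ p q : ℕ, p.Prime → q.Prime → p ≠ q → (p * q) % 9 = 1 →
        ((p % 3 = 1 ∧ q % 3 = 1) ∨ (p % 9 = 2 ∧ q % 9 = 5) ∨ (p % 9 = 5 ∧ q % 9 = 2)) →
        (2 : ℝ) / 3 ≤ D.pr id (encodeNat (p * q)) {b | b = decide (p % 3 = 1)} := by
  obtain ⟨D, hD, hpr⟩ := exists_randAlg_minFac_mod_three_of_BQP_subset_BPP hsub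
  refine ⟨D, hD, fun p q hp hq _ _ htype => ?_⟩
  have h2 : 2 ≤ p * q := le_trans hp.two_le (Nat.le_mul_of_pos_right p hq.pos)
  have hres : (p * q).minFac % 3 = p % 3 := by
    rcases minFac_mul_eq_or hp hq with h | h
    · rw [h]
    · rw [h]; omega
  have hdec : decide ((p * q).minFac % 3 = 1) = decide (p % 3 = 1) := by rw [hres]
  have h := hpr (p * q) h2
  rw [hdec] at h
  linarith

end Literature.Computability.Cryptography
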